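import Literature.AlgebraicGeometry.Modules.DetClassTensor
import Literature.AlgebraicGeometry.Modules.DetClassDual
import Literature.AlgebraicGeometry.Modules.PullbackFrame
import Literature.AlgebraicGeometry.Motives.SubschemeCycles
import HarnessLib

/-!
# The fibre class of the seesaw sheaf `𝓕 = q₁₂^*ℳ ⊗ (q₁₃^*𝒫)^∨` on `A × (T × B)` at a point `(t, b)`

Layer `Literature/AlgebraicGeometry/AbelianVarieties`, namespace `Literature.AlgebraicGeometry.AbelianVarieties`. THEOREMS ONLY
plus one private functoriality lemma; no named fact, no instance, no notation. Cell `hodgecm-mathlib` (D-0151), M1PRIME-DAG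
rung 0, J0b road (i) input (P-a) for the (R3a) assembly «`universal` on normal `T`» (B-p02 lineage), in the B-p07 (J0a)
currency (`SchemeOver K`, cartesian-monoidal slices, classes in `Ȟ¹(–, 𝒪^×)` = `CechPic`/`detClass`).

Setting ([MilneAV2008] I §8, proof of Thm. 8.? / [MumfordAV1970] §13, the seesaw argument): `K` a field, `A T B : SchemeOver K`
(in the application `A` an abelian variety, `B = Â`), line bundles `ℳ` on `A × T` and `𝒫` on `A × B`, and
`𝓕 := q₁₂^*ℳ ⊗ (q₁₃^*𝒫)^∨` on `A × (T × B)` with `q₁₂ = 1_A × p₁`, `q₁₃ = 1_A × p₂` (whisker form `A ◁ fst T B`,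
`A ◁ snd T B`). For `K`-points `t` of `T` and `b` of `B`:

* `sliceAt_comp_whiskerLeft_fst` / `_snd` — the slice `(𝟙, (t, b)) : A → A × (T × B)` followed by `q₁₂` / `q₁₃` is the slice
  `(𝟙, t) : A → A × T` / `(𝟙, b) : A → A × B`;
* **`detClass_pullback_sliceAt_seesawSheaf`** — `[𝓕|_{A × {(t,b)}}] = [ℳ|_{A × {t}}] · [𝒫|_{A × {b}}]⁻¹` in `Ȟ¹(A, 𝒪_A^×)`
  (★ `detClass_tensorObj_of_hasRank_one`, ★ `detClass_dual`, ★ `detClass_pullback`).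

Banked capital; HC_CM is proved only modulo the 7 printed citations until rung 0 closes.

## References

* [MilneAV2008] J. S. Milne, *Abelian Varieties* (2008), I §8 (pp. 36–40) (the seesaw proof of the universal property).
* [MumfordAV1970] D. Mumford, *Abelian Varieties* (1970), §13 (p. 125) and §5 Cor. 6 (seesaw).
* [Hartshorne1977] R. Hartshorne, *Algebraic Geometry*, II Ex. 5.16, 6.11, III Ex. 4.5 (determinant classes, `Pic = Ȟ¹(𝒪^×)`).
-/

noncomputable section

open CategoryTheory AlgebraicGeometry MonoidalCategory CartesianMonoidalCategory Opposite
open Literature.AlgebraicGeometry.Motives Literature.AlgebraicGeometry.Modules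

universe u

namespace Literature.AlgebraicGeometry.AbelianVarieties

variable {K : Type u} [Field K] (A T B : SchemeOver K)

/-- `(f ≫ g)^* = f^* ∘ g^*` on `Ȟ¹(–, 𝒪^×)` (the tree's `CechPic.pullback_comp`, re-proved privately to keep the import cone
small). [cite: Hartshorne1977, II Ex. 6.8 (functoriality of f^* on Pic)] -/
private theorem cechPic_pullback_comp {X Y Z : Scheme.{u}} (f : X ⟶ Y) (g : Y ⟶ Z) (c : CechPic Z) :
    CechPic.pullback (f ≫ g) c = CechPic.pullback f (CechPic.pullback g c) := by
  obtain ⟨c, rfl⟩ := CechPic.mk_surjective c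
  rw [CechPic.pullback_mk, CechPic.pullback_mk, CechPic.pullback_mk]
  refine CechPic.sound (UnitCocycle.equiv_of_eq _ _
    (fun x => f ⁻¹ᵁ (g ⁻¹ᵁ c.U (g.base (f.base x)))) (fun x => c.mem (g.base (f.base x)))
    (fun x => le_of_eq rfl) (fun x => le_rfl) fun x y V hx hy => ?_)
  change (g.appLE _ _ _ ≫ f.appLE _ V _) (c.g _ _ _ _ _) = (f ≫ g).appLE _ V _ (c.g _ _ _ _ _)
  rw [Scheme.Hom.appLE_comp_appLE]
  rfl

/-- **Slice square, first projection**: `(𝟙, (t, b)) ≫ (1_A × p₁) = (𝟙, t)`. [cite: MilneAV2008, I §8 (pp. 36–40)] -/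
theorem sliceAt_comp_whiskerLeft_fst (t : AlgPoints T K) (b : AlgPoints B K) :
    lift (𝟙 A) (toSpecOver A ≫ lift t b) ≫ A ◁ fst T B = lift (𝟙 A) (toSpecOver A ≫ t) := by
  refine CartesianMonoidalCategory.hom_ext _ _ ?_ ?_
  · rw [Category.assoc, whiskerLeft_fst, lift_fst, lift_fst]
  · rw [Category.assoc, whiskerLeft_snd, lift_snd_assoc, lift_snd, Category.assoc, lift_fst]

/-- **Slice square, second projection**: `(𝟙, (t, b)) ≫ (1_A × p₂) = (𝟙, b)`. [cite: MilneAV2008, I §8 (pp. 36–40)] -/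
theorem sliceAt_comp_whiskerLeft_snd (t : AlgPoints T K) (b : AlgPoints B K) :
    lift (𝟙 A) (toSpecOver A ≫ lift t b) ≫ A ◁ snd T B = lift (𝟙 A) (toSpecOver A ≫ b) := by
  refine CartesianMonoidalCategory.hom_ext _ _ ?_ ?_
  · rw [Category.assoc, whiskerLeft_fst, lift_fst, lift_fst]
  · rw [Category.assoc, whiskerLeft_snd, lift_snd_assoc, lift_snd, Category.assoc, lift_snd]

variable {A T B}
variable {M : (A ⊗ T).left.Modules} {P : (A ⊗ B).left.Modules}

/-- The seesaw sheaf `𝓕 = q₁₂^*M ⊗ (q₁₃^*P)^∨` on `A × (T × B)` is a line bundle. [cite: MilneAV2008, I §8 (pp. 36–40)] -/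
theorem hasRank_seesawSheaf (hM : HasRank M 1) (hP : HasRank P 1) :
    HasRank (tensorObj ((Scheme.Modules.pullback (A ◁ fst T B).left).obj M)
      (Modules.dual ((Scheme.Modules.pullback (A ◁ snd T B).left).obj P))) 1 :=
  hasRank_tensorObj_one (hasRank_pullback _ hM) (hasRank_dual (hasRank_pullback _ hP))

/-- **The fibre class of the seesaw sheaf**: for `K`-points `t` of `T` and `b` of `B`,
`[𝓕|_{A × {(t,b)}}] = [M|_{A × {t}}] · [P|_{A × {b}}]⁻¹` in `Ȟ¹(A, 𝒪_A^×)`, where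
`𝓕 = q₁₂^*M ⊗ (q₁₃^*P)^∨` («`𝓕|_{A × (t,b)} ≈ M_t ⊗ P_b⁻¹`», the first line of the seesaw proof of the universal property
of `(Â, P)`). The determinant classes are computed from any proofs of local freeness. [cite: MilneAV2008, I §8 (pp. 36–40)]
[cite: MumfordAV1970, §13 (p. 125)] -/
theorem detClass_pullback_sliceAt_seesawSheaf (hM : HasRank M 1) (hP : HasRank P 1) (t : AlgPoints T K) (b : AlgPoints B K)
    (h𝓕 : IsFiniteLocallyFree (tensorObj ((Scheme.Modules.pullback (A ◁ fst T B).left).obj M)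
      (Modules.dual ((Scheme.Modules.pullback (A ◁ snd T B).left).obj P))))
    (hMt : IsFiniteLocallyFree ((Scheme.Modules.pullback (lift (𝟙 A) (toSpecOver A ≫ t)).left).obj M))
    (hPb : IsFiniteLocallyFree ((Scheme.Modules.pullback (lift (𝟙 A) (toSpecOver A ≫ b)).left).obj P)) :
    detClass (h𝓕.pullback (lift (𝟙 A) (toSpecOver A ≫ lift t b)).left) =
      detClass hMt * (detClass hPb)⁻¹ := by
  have hM' : IsFiniteLocallyFree M := HasRank.isFiniteLocallyFree' hM
  have hP' : IsFiniteLocallyFree P := HasRank.isFiniteLocallyFree' hP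
  have h12 : IsFiniteLocallyFree ((Scheme.Modules.pullback (A ◁ fst T B).left).obj M) := hM'.pullback _
  have h13 : IsFiniteLocallyFree ((Scheme.Modules.pullback (A ◁ snd T B).left).obj P) := hP'.pullback _
  -- `[𝓕] = q₁₂^*[M] · (q₁₃^*[P])⁻¹`
  have h𝓕cl : detClass h𝓕 = CechPic.pullback (A ◁ fst T B).left (detClass hM') *
      (CechPic.pullback (A ◁ snd T B).left (detClass hP'))⁻¹ := by
    rw [detClass_tensorObj_of_hasRank_one (hasRank_pullback _ hM) (hasRank_dual (hasRank_pullback _ hP)) h12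
      (isFiniteLocallyFree_dual h13) h𝓕, detClass_dual h13, detClass_pullback _ hM', detClass_pullback _ hP']
  -- pull back along the slice and use the two slice squares
  have e1 : (lift (𝟙 A) (toSpecOver A ≫ lift t b)).left ≫ (A ◁ fst T B).left = (lift (𝟙 A) (toSpecOver A ≫ t)).left := by
    rw [← Over.comp_left, sliceAt_comp_whiskerLeft_fst]
  have e2 : (lift (𝟙 A) (toSpecOver A ≫ lift t b)).left ≫ (A ◁ snd T B).left = (lift (𝟙 A) (toSpecOver A ≫ b)).left := by
    rw [← Over.comp_left, sliceAt_comp_whiskerLeft_snd]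
  rw [detClass_pullback _ h𝓕, h𝓕cl, MonoidHom.map_mul, MonoidHom.map_inv, ← cechPic_pullback_comp,
    ← cechPic_pullback_comp, e1, e2, ← detClass_pullback _ hM', ← detClass_pullback _ hP']

end Literature.AlgebraicGeometry.AbelianVarieties

end
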